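import Summits.CriticalPhenomena.CardyFormulaZ2.Theorems.CardyWhiteToColouredSimilarityUpgradeStubScalingFnRegular
import Summits.CriticalPhenomena.CardyFormulaZ2.Theorems.CardyWhiteToColouredSimilarityUpgradeStubScalingFnDual

/-!
# Stub `stub_scalingFnEndpoints` (line `registered`, crux `SimilarityUpgrade`, stmt-CriticalPhenomena-4597)

Crux `Summit.CriticalPhenomena.CardyFormulaZ2.Theses.CardyWhiteToColoured.SimilarityUpgrade`,
route `CardyWhiteToColoured`, sub-problem `CardyFormulaZ2`, line `registered`, c5 goal stub
`stub_scalingFnEndpoints`: a documentary consequence of the crux conclusion `X_U`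
(`∃ f, ∀ R, R.HasCrossingLimit (bondDomainCrossingProb R) f`) for the sibling crux
`CardyRigidity` (stmt-CriticalPhenomena-0746).  Every scaling function `f` of a conformally
invariant bond-`ℤ²` crossing limit has the **endpoint values of Cardy's function**:
`f t → 0` as `t → 0⁺` and `f t → 1` as `t → 1⁻`.  Together with the landed siblings
(`stub_scalingFnRegular`: `f` is continuous, strictly increasing and `(0,1)`-valued on `(0,1)`;
`stub_scalingFnDual`: `f (1 - t) = 1 - f t`) this makes `f` an increasing self-dual homeomorphism
of `[0,1]` once extended by `f 0 = 0`, `f 1 = 1`.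

Proof.  From `h : ∀ R, R.HasCrossingLimit (bondDomainCrossingProb R) f` and one uniformizing datum
`(ψ R, y R)` per conformal rectangle (`MarkedDomain.exists_isUniformizing_holds`) we get full
limits `Φ R := f (crossRatio (y R))`, `bondDomainCrossingProb R δ → Φ R` as `δ → 0⁺`.
* **Long boxes are rarely crossed** (`scalingFnEndpoints_submult`, `scalingFnEndpoints_small`).
  For c1's left-to-right box family `Q w = sh (Q' w)` (carrier `(0,w) × (0,1)`, arcs `0, 2` the
  left and right sides; `RectangleFamily.lr_family`) the full limit is SUB-MULTIPLICATIVE in the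
  width, `Φ (Q (w₁ + w₂)) ≤ Φ (Q w₁) Φ (Q w₂)`: at the fitted meshes `δ = 1/(k+2)` the three
  crossing probabilities are the lattice crossing probabilities `h(a₁, k)`, `h(a₂, k)`, `h(A, k)`
  of the windows `aᵢ + 1 < wᵢ (k+2) ≤ aᵢ + 2`, `A + 1 < (w₁ + w₂)(k+2) ≤ A + 2`
  (`RectangleDuality.bond_lr_eq`), so `a₁ + a₂ + 1 ≤ A` and
  `h(A, k) ≤ h(a₁ + a₂ + 1, k) ≤ h(a₁, k) h(a₂, k)` by monotonicity in the width
  (`crossingProb_anti_left`) and sub-multiplicativity over vertex-disjoint blocks (independence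
  under the product measure, `StripClusterRates.Negative.pOne_add_le`); pass to the limit
  `k → ∞`.  Iterating from the unit square, `Φ (Q (n+1)) ≤ Φ (Q 1)^(n+1) → 0` since
  `Φ (Q 1) < 1` (RSW, `discreteCrossingProb_clusterPt_mem_Ioo_holds`).
* Hence for every `ε > 0` some modulus `t₀ = crossRatio (y (Q (n+1))) ∈ (0,1)`
  (`ConformalRectangle.crossRatio_mem_Ioo_of_isUniformizing`) has `f t₀ = Φ (Q (n+1)) < ε`, and
  by monotonicity and positivity (`stub_scalingFnRegular`) `0 < f t < ε` on `(0, t₀)`: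
  `f → 0` at `0⁺`.
* At `1⁻` use self-duality `f t = 1 - f (1 - t)` (`stub_scalingFnDual`) and the limit at `0⁺`.
No definitions are introduced.

References: B. Bollobás, O. Riordan, *Percolation* (2006), Ch. 3, Lemma 1, eq. (2)–(3) and
Corollary 3 (RSW, sub-multiplicativity); G. Grimmett, *Percolation*, 2nd ed. (1999), §11.7;
O. Schramm, S. Smirnov, Ann. Probab. 39 (2011), Lemma 5.1; J. Cardy, J. Phys. A 25 (1992) L201.
-/

noncomputable section

namespace Summit.CriticalPhenomena.CardyFormulaZ2.Cruxes.SimilarityUpgrade.Stubs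

open Filter Topology Set MeasureTheory
open Literature.Probability.RandomPlanarGeometry
open Literature.Probability.Percolation

/-! ## Long boxes are rarely crossed, uniformly in the mesh -/

open RectangleDuality in
open Summit.CriticalPhenomena.CardyFormulaZ2.Cruxes.SubseqCardy.Birth (JointLimit.exists_window) in
open Summit.CriticalPhenomena.CardyFormulaZ2.Theorems.StripClusterRates.Negative (pOne_add_le) in
/-- **Sub-multiplicativity of the box crossing limit in the width.** If the bond-`ℤ²` crossing
probability of every conformal rectangle converges (to `Φ`) as the mesh tends to `0⁺`, then for
every left–right box family `Q` (carrier `(0, w) × (0, 1)`, arcs `0`, `2` the left and right sides)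
`Φ (Q (w₁ + w₂)) ≤ Φ (Q w₁) * Φ (Q w₂)`.  At the fitted meshes `1/(k+2)` the three crossing
probabilities are lattice crossing probabilities `h(A, k)`, `h(a₁, k)`, `h(a₂, k)` of windows with
`a₁ + a₂ + 1 ≤ A` (`bond_lr_eq`), and `h(A, k) ≤ h(a₁ + a₂ + 1, k) ≤ h(a₁, k) h(a₂, k)`
(`crossingProb_anti_left`, `pOne_add_le`: independence of vertex-disjoint blocks); pass to the
limit. [cite: BollobasRiordan2006, Ch. 3, Lemma 1, eq. (2)–(3)] -/
theorem scalingFnEndpoints_submult (Φ : ConformalRectangle → ℝ)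
    (hΦ : ∀ R : ConformalRectangle, Tendsto (bondDomainCrossingProb R) (𝓝[>] (0 : ℝ)) (𝓝 (Φ R)))
    (Q : ℝ → ConformalRectangle)
    (hQ : ∀ w : ℝ, 0 < w → (Q w).carrier = (Ioo (0 : ℝ) w ×ℂ Ioo (0 : ℝ) 1) ∧
      (Q w).arc 0 = {z : ℂ | z.re = 0 ∧ z.im ∈ Icc (0 : ℝ) 1} ∧
      (Q w).arc 2 = {z : ℂ | z.re = w ∧ z.im ∈ Icc (0 : ℝ) 1})
    {w₁ w₂ : ℝ} (hw₁ : 0 < w₁) (hw₂ : 0 < w₂) :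
    Φ (Q (w₁ + w₂)) ≤ Φ (Q w₁) * Φ (Q w₂) := by
  have hw : 0 < w₁ + w₂ := add_pos hw₁ hw₂
  have hlimk : ∀ R : ConformalRectangle,
      Tendsto (fun k : ℕ => bondDomainCrossingProb R (1 / ((k : ℝ) + 2))) atTop (𝓝 (Φ R)) :=
    fun R => (hΦ R).comp boxStrictAnti_tendsto_mesh
  -- the window of `Q w` at the fitted mesh `1/(k+2)` and the lattice crossing probability
  have hwin : ∀ (w : ℝ) (k : ℕ), 0 < w → 2 < w * ((k : ℝ) + 2) → ∃ a : ℕ,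
      (a : ℝ) + 1 < w * ((k : ℝ) + 2) ∧ w * ((k : ℝ) + 2) ≤ (a : ℝ) + 2 ∧
      bondDomainCrossingProb (Q w) (1 / ((k : ℝ) + 2)) = crossingProb half a k := by
    intro w k hw0 hxw
    have hK : (0 : ℝ) < (k : ℝ) + 2 := by positivity
    obtain ⟨a, ha1, ha2⟩ := JointLimit.exists_window (x := w * ((k : ℝ) + 2)) (by linarith)
    have hδ : (0 : ℝ) < 1 / ((k : ℝ) + 2) := by positivity
    have hb : 1 / ((k : ℝ) + 2) * ((k : ℝ) + 2) = 1 := one_div_mul_cancel hK.ne'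
    have h1a : 1 ≤ a := by
      have : (0 : ℝ) < a := by linarith
      have : 0 < a := by exact_mod_cast this
      omega
    have ha : 1 / ((k : ℝ) + 2) * (a + 1) < w := by
      rwa [one_div_mul_eq_div, div_lt_iff₀ hK]
    have ha' : w ≤ 1 / ((k : ℝ) + 2) * (a + 2) := by
      rwa [one_div_mul_eq_div, le_div_iff₀ hK]
    exact ⟨a, ha1, ha2,
      bond_lr_eq (Q w) (hQ w hw0).1 (hQ w hw0).2.1 (hQ w hw0).2.2 hδ ha ha' hb h1a⟩
  have key : ∀ᶠ k : ℕ in atTop, bondDomainCrossingProb (Q (w₁ + w₂)) (1 / ((k : ℝ) + 2)) ≤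
      bondDomainCrossingProb (Q w₁) (1 / ((k : ℝ) + 2)) *
        bondDomainCrossingProb (Q w₂) (1 / ((k : ℝ) + 2)) := by
    obtain ⟨K₁, hK₁⟩ := exists_nat_ge (2 / w₁)
    obtain ⟨K₂, hK₂⟩ := exists_nat_ge (2 / w₂)
    filter_upwards [eventually_ge_atTop (max K₁ K₂)] with k hk
    have hkK₁ : (K₁ : ℝ) ≤ k := by exact_mod_cast le_of_max_le_left hk
    have hkK₂ : (K₂ : ℝ) ≤ k := by exact_mod_cast le_of_max_le_right hk
    have h2w₁ : 2 / w₁ ≤ k := by linarith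
    have h2w₂ : 2 / w₂ ≤ k := by linarith
    rw [div_le_iff₀ hw₁] at h2w₁
    rw [div_le_iff₀ hw₂] at h2w₂
    have hx₁ : 2 < w₁ * ((k : ℝ) + 2) := by nlinarith
    have hx₂ : 2 < w₂ * ((k : ℝ) + 2) := by nlinarith
    have hx : 2 < (w₁ + w₂) * ((k : ℝ) + 2) := by nlinarith
    obtain ⟨a₁, ha₁, -, e₁⟩ := hwin w₁ k hw₁ hx₁
    obtain ⟨a₂, ha₂, -, e₂⟩ := hwin w₂ k hw₂ hx₂
    obtain ⟨A, -, hA, e⟩ := hwin (w₁ + w₂) k hw hx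
    have hAa : a₁ + a₂ + 1 ≤ A := by
      have : (a₁ : ℝ) + a₂ < A := by nlinarith
      have : a₁ + a₂ < A := by exact_mod_cast this
      omega
    rw [e₁, e₂, e]
    exact (crossingProb_anti_left half hAa k).trans (pOne_add_le a₁ a₂ k)
  exact le_of_tendsto_of_tendsto (hlimk (Q (w₁ + w₂))) ((hlimk (Q w₁)).mul (hlimk (Q w₂))) key

/-- **Long boxes are rarely crossed.** Under the hypotheses of `scalingFnEndpoints_submult`, for
every `ε > 0` some box `Q w` has full limit `Φ (Q w) < ε`: iterating sub-multiplicativity from the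
unit square, `Φ (Q (n+1)) ≤ Φ (Q 1)^(n+1)`, and `Φ (Q 1) < 1` by Russo–Seymour–Welsh
(`discreteCrossingProb_clusterPt_mem_Ioo_holds`).
[cite: BollobasRiordan2006, Ch. 3, Lemma 1 and Corollary 3] -/
theorem scalingFnEndpoints_small (Φ : ConformalRectangle → ℝ)
    (hΦ : ∀ R : ConformalRectangle, Tendsto (bondDomainCrossingProb R) (𝓝[>] (0 : ℝ)) (𝓝 (Φ R)))
    (Q : ℝ → ConformalRectangle)
    (hQ : ∀ w : ℝ, 0 < w → (Q w).carrier = (Ioo (0 : ℝ) w ×ℂ Ioo (0 : ℝ) 1) ∧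
      (Q w).arc 0 = {z : ℂ | z.re = 0 ∧ z.im ∈ Icc (0 : ℝ) 1} ∧
      (Q w).arc 2 = {z : ℂ | z.re = w ∧ z.im ∈ Icc (0 : ℝ) 1})
    {ε : ℝ} (hε : 0 < ε) : ∃ w : ℝ, 0 < w ∧ Φ (Q w) < ε := by
  have hIoo : ∀ w : ℝ, Φ (Q w) ∈ Ioo (0 : ℝ) 1 := fun w =>
    discreteCrossingProb_clusterPt_mem_Ioo_holds (Q w) (hΦ (Q w)).mapClusterPt
  have hpow : ∀ n : ℕ, Φ (Q ((n : ℝ) + 1)) ≤ Φ (Q 1) ^ (n + 1) := by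
    intro n
    induction n with
    | zero => simp
    | succ n ih =>
      push_cast
      calc Φ (Q ((n : ℝ) + 1 + 1)) ≤ Φ (Q ((n : ℝ) + 1)) * Φ (Q 1) :=
            scalingFnEndpoints_submult Φ hΦ Q hQ (by positivity) one_pos
        _ ≤ Φ (Q 1) ^ (n + 1) * Φ (Q 1) := mul_le_mul_of_nonneg_right ih (hIoo 1).1.le
        _ = Φ (Q 1) ^ (n + 1 + 1) := by ring
  obtain ⟨n, hn⟩ := exists_pow_lt_of_lt_one hε (hIoo 1).2
  exact ⟨(n : ℝ) + 1, by positivity, (hpow n).trans_lt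
    ((pow_le_pow_of_le_one (hIoo 1).1.le (hIoo 1).2.le n.le_succ).trans_lt hn)⟩

/-! ## The endpoint limits -/

/-- **stub_scalingFnEndpoints.** Every scaling function `f` of a conformally invariant bond-`ℤ²`
crossing limit (`∀ R, R.HasCrossingLimit (bondDomainCrossingProb R) f`) tends to `0` at `0⁺` and
to `1` at `1⁻`: long boxes are rarely crossed uniformly in the mesh (`scalingFnEndpoints_small`:
sub-multiplicativity over vertex-disjoint blocks and RSW), so `f` takes arbitrarily small values at
moduli in `(0,1)`; `f` is increasing and positive on `(0,1)` (`stub_scalingFnRegular`), whence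
`f → 0` at `0⁺`; and `f (1 - t) = 1 - f t` (`stub_scalingFnDual`) transports this to `1⁻`.
[cite: BollobasRiordan2006, Ch. 3, Lemma 1, eq. (2)–(3) and Corollary 3]
[cite: SchrammSmirnov2011, Lemma 5.1] -/
theorem stub_scalingFnEndpoints : ∀ f : ℝ → ℝ, (∀ R : ConformalRectangle, R.HasCrossingLimit (bondDomainCrossingProb R) f) → Tendsto f (𝓝[>] (0 : ℝ)) (𝓝 0) ∧ Tendsto f (𝓝[<] (1 : ℝ)) (𝓝 1) := by
  intro f h
  obtain ⟨-, hmono, hmaps⟩ := stub_scalingFnRegular f h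
  obtain ⟨hdual, -⟩ := stub_scalingFnDual f h
  -- one uniformizing datum per conformal rectangle: the full limits `Φ R := f (crossRatio (y R))`
  choose ψ y hψ using fun R : ConformalRectangle => MarkedDomain.exists_isUniformizing_holds R
  have hlim : ∀ R : ConformalRectangle,
      Tendsto (bondDomainCrossingProb R) (𝓝[>] (0 : ℝ)) (𝓝 (f (crossRatio (y R)))) :=
    fun R => h R (ψ R) (y R) (hψ R)
  -- c1's left-to-right family of corner-marked boxes `Q w = sh (Q' w)`, `Q' w = rectQuad 0 w 0 1`
  choose sh hsh using RectangleFamily.exists_shift3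
  obtain ⟨Q', hQ'⟩ : ∃ Q' : ℝ → ConformalRectangle,
      ∀ (w : ℝ) (hw : 0 < w), Q' w = rectQuad 0 w 0 1 hw one_pos :=
    ⟨fun w => if hw : 0 < w then rectQuad 0 w 0 1 hw one_pos else rectQuad 0 1 0 1 one_pos one_pos,
      fun w hw => dif_pos hw⟩
  -- `f` takes arbitrarily small values at moduli in `(0,1)`
  have hsmall : ∀ ε : ℝ, 0 < ε → ∃ t₀ ∈ Ioo (0 : ℝ) 1, f t₀ < ε := by
    intro ε hε
    obtain ⟨w, -, hw⟩ := scalingFnEndpoints_small (fun R => f (crossRatio (y R))) hlim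
      (fun w => sh (Q' w)) (RectangleFamily.lr_family sh hsh Q' hQ') hε
    exact ⟨crossRatio (y (sh (Q' w))),
      ConformalRectangle.crossRatio_mem_Ioo_of_isUniformizing (hψ _), hw⟩
  -- the limit at `0⁺`
  have h0 : Tendsto f (𝓝[>] (0 : ℝ)) (𝓝 0) := by
    rw [Metric.tendsto_nhdsWithin_nhds]
    intro ε hε
    obtain ⟨t₀, ht₀, hft₀⟩ := hsmall ε hε
    refine ⟨t₀, ht₀.1, ?_⟩
    intro x hx hdist
    have hx0 : 0 < x := hx
    rw [Real.dist_eq, sub_zero, abs_of_pos hx0] at hdist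
    have hx1 : x ∈ Ioo (0 : ℝ) 1 := ⟨hx0, hdist.trans ht₀.2⟩
    have hlt : f x < f t₀ := hmono hx1 ht₀ hdist
    have hfx : f x ∈ Ioo (0 : ℝ) 1 := hmaps hx1
    rw [Real.dist_eq, sub_zero, abs_of_pos hfx.1]
    linarith
  refine ⟨h0, ?_⟩
  -- the limit at `1⁻` by self-duality
  rw [Metric.tendsto_nhdsWithin_nhds] at h0 ⊢
  intro ε hε
  obtain ⟨δ, hδ, hδ'⟩ := h0 ε hε
  refine ⟨min δ 1, lt_min hδ one_pos, ?_⟩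
  intro x hx hdist
  have hx1 : x < 1 := hx
  rw [Real.dist_eq, abs_sub_comm, abs_of_pos (by linarith)] at hdist
  have hxδ : 1 - x < δ := hdist.trans_le (min_le_left _ _)
  have hx0 : 0 < x := by linarith [hdist.trans_le (min_le_right _ _)]
  have key := hδ' (show 1 - x ∈ Ioi (0 : ℝ) from mem_Ioi.2 (by linarith))
    (by rwa [Real.dist_eq, sub_zero, abs_of_pos (by linarith)])
  have hd := hdual x ⟨hx0, hx1⟩
  rw [Real.dist_eq] at key ⊢
  rw [show f x - 1 = -(f (1 - x) - 0) by linarith, abs_neg]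
  exact key

end Summit.CriticalPhenomena.CardyFormulaZ2.Cruxes.SimilarityUpgrade.Stubs

end
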